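import Literature.NumberTheory.EllipticCurves.PadicSigmaOfZetaSeriesProofs
import HarnessLib

/-!
# The Mazur–Tate sigma function exists as soon as the differential `ζ·ω` satisfies the
# Atkin–Swinnerton-Dyer/Dwork congruences `d_{mp} ≡ d_m (mod mp)` (proofs only)

Trunk T-NT-EC (Literature/NumberTheory/EllipticCurves). `PadicSigmaOfZetaSeriesProofs.lean` reduced
the tree's named fact `WeierstrassCurve.mazur_tate_sigma_existsUnique` (Mazur–Stein–Tate 2006,
Thm. 1.3) to Blakestad–Grant's Thm. 1 in the form "`exp(g)` has coefficients in `ℤ_p`", where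
`zg' = Λ·ω/dz - 1` for the even integral zeta series `Λ` (`ζ = Λ/z`, `Dζ = -x + β`,
Blakestad–Grant Thm. 2). By Dieudonné–Dwork / Hazewinkel's functional equation lemma with the
identity as Frobenius endomorphism of `ℤ_p` (`rᵖ ≡ r (mod p)` on `ℤ_p`) — Blakestad–Grant's
Cor. 6 (a)(b), tree `FunctionalEquationIntegrality.lean` — that integrality follows from (in fact
is equivalent to) the congruences

  **`d_{mp} ≡ d_m (mod mp·ℤ_p)`  (`m ≥ 1`),  `Λ·ω/dz = Σ_k d_k z^k`,**

i.e. congruences of Atkin–Swinnerton-Dyer type for the coefficients of the differential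
`ζω = (Σ_k d_k z^{k-1}) dz` ("the existence of `ζ` can be viewed as a set of congruences … we
derive the integrality of the coefficients of `σ` via Hazewinkel's functional equation lemma, which
entails deriving congruences between coefficients of `ζ`", Blakestad–Grant, Introduction). This
file proves that implication over `ℚ_p` and records the resulting reduction of the named fact:

* `padicInt_exists_eq_pow_add` — `r = rᵖ + p·a` with `a ∈ ℤ_p` for `r ∈ ℤ_p` (Fermat in
  `ℤ_p/p = 𝔽_p`): the identity is a Frobenius lift on `ℤ_p`;
* `padic_exists_pow_mul_mem_subring`, `padic_inv_natCast_mem_subring` — `ℚ_p = ℤ_p[1/p]`,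
  `ℤ_(p) ⊆ ℤ_p`;
* `isPadicInt_exp_subst_of_norm_sub_le` — **Dieudonné–Dwork for `ℚ_p`**: if `g(0) = 0`,
  `zg' = Σ_{n≥1} c_{n-1} zⁿ` with `c_n ∈ ℤ_p` and `‖c_{np-1} - c_{n-1}‖ ≤ ‖np‖` for all `n ≥ 1`,
  then `exp(g) ∈ ℤ_p⟦z⟧` (Blakestad–Grant Cor. 6(a)+(b) with `α = id`);
* `mazur_tate_sigma_existsUnique_of_zeta_congruences` — **the named fact follows from the
  congruences `‖d_{(n+1)p} - d_{n+1}‖ ≤ ‖(n+1)p‖` for the coefficients `d_k = [z^k](Λ·ω/dz)` of the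
  even integral zeta series of every short `p`-integral ordinary model over `ℚ_p`, `p ≥ 5`.**

## Sources

* C. Blakestad, D. Grant, J. Number Theory 249 (2023) (arXiv:1903.02480), Introduction (quoted
  above), §2.2: Lemma 5, Cor. 6 (a) ("`exp(a(t))` has coefficients in `R̂`"), (b) ("if and only if
  … `c_{np-1} ≡ α(c_{n-1}) mod pn`"), Thm. 1. [BlakestadGrant2023]
* N. Koblitz, *p-adic Numbers, p-adic Analysis, and Zeta-Functions*, GTM 58 (1984), Ch. IV §2
  (Dwork's lemma over `ℤ_p`), as vendored in `DworkFrobeniusLift.lean`. [Koblitz1984]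
* B. Mazur, W. Stein, J. Tate, Doc. Math. Extra Vol. Coates (2006), Thm. 1.3. [MazurSteinTate2006]

Pure proof file: no definitions, no named facts.
-/

noncomputable section

open PowerSeries Literature.NumberTheory.EllipticCurves Literature.RingTheory.FormalGroups

namespace WeierstrassCurve

section PadicGlue

variable (p : ℕ) [Fact p.Prime]

/-- **The identity is a Frobenius lift on `ℤ_p`**: `r = rᵖ + p·a` with `a ∈ ℤ_p` for every
`r ∈ ℤ_p` (`rᵖ ≡ r (mod p)`, Fermat in the residue field `𝔽_p`). [Koblitz GTM 58, IV §2]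
[folklore] -/
theorem _root_.Literature.NumberTheory.EllipticCurves.padicInt_exists_eq_pow_add :
    ∀ r ∈ PadicInt.subring p, ∃ a ∈ PadicInt.subring p, RingHom.id ℚ_[p] r = r ^ p + p * a := by
  intro r hr
  set z : ℤ_[p] := ⟨r, (PadicInt.mem_subring_iff p).mp hr⟩ with hz
  have hker : z ^ p - z ∈ RingHom.ker (PadicInt.toZMod : ℤ_[p] →+* ZMod p) := by
    rw [RingHom.mem_ker, map_sub, map_pow, ZMod.pow_card, sub_self]
  rw [PadicInt.ker_toZMod, PadicInt.maximalIdeal_eq_span_p, Ideal.mem_span_singleton'] at hker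
  obtain ⟨w, hw⟩ := hker
  refine ⟨((-w : ℤ_[p]) : ℚ_[p]), (PadicInt.mem_subring_iff p).mpr (PadicInt.norm_le_one _), ?_⟩
  have h := congrArg (fun t : ℤ_[p] => (t : ℚ_[p])) hw
  simp only [PadicInt.coe_mul, PadicInt.coe_natCast, PadicInt.coe_sub, PadicInt.coe_pow] at h
  have hzr : ((z : ℤ_[p]) : ℚ_[p]) = r := rfl
  rw [hzr] at h
  rw [RingHom.id_apply, PadicInt.coe_neg]
  linear_combination h

/-- **`ℚ_p = ℤ_p[1/p]`**: every `x ∈ ℚ_p` has `pᵏx ∈ ℤ_p` for some `k`. [folklore] -/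
theorem _root_.Literature.NumberTheory.EllipticCurves.padic_exists_pow_mul_mem_subring (x : ℚ_[p]) :
    ∃ k : ℕ, (p : ℚ_[p]) ^ k * x ∈ PadicInt.subring p := by
  have hp : p.Prime := Fact.out
  have hp1 : (1 : ℝ) < p := by exact_mod_cast hp.one_lt
  obtain ⟨k, hk⟩ := pow_unbounded_of_one_lt ‖x‖ hp1
  refine ⟨k, (PadicInt.mem_subring_iff p).mpr ?_⟩
  rw [norm_mul, norm_pow, Padic.norm_p]
  have hpk : (0 : ℝ) < (p : ℝ) ^ k := by positivity
  rw [inv_pow, ← div_eq_inv_mul, div_le_one hpk]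
  exact hk.le

/-- **`ℤ_(p) ⊆ ℤ_p`**: `1/m ∈ ℤ_p` for `p ∤ m`. [folklore] -/
theorem _root_.Literature.NumberTheory.EllipticCurves.padic_inv_natCast_mem_subring :
    ∀ m : ℕ, ¬ p ∣ m → algebraMap ℚ ℚ_[p] (1 / m) ∈ PadicInt.subring p := by
  intro m hm
  rw [PadicInt.mem_subring_iff, map_div₀, map_one, map_natCast, one_div, norm_inv]
  have h : ‖(m : ℚ_[p])‖ = 1 := by
    rw [Padic.norm_natCast_eq_one_iff]
    exact (Nat.Prime.coprime_iff_not_dvd Fact.out).mpr hm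
  rw [h, inv_one]

end PadicGlue

/-! ### Dieudonné–Dwork over `ℚ_p` -/

section Dwork

variable {p : ℕ} [Fact p.Prime]

/-- **Dieudonné–Dwork / Hazewinkel over `ℚ_p` (Blakestad–Grant Cor. 6 (a)+(b) with `α = id`).**
Let `g ∈ zℚ_p⟦z⟧` with `zg' = Σ_{n ≥ 1} c_{n-1} zⁿ`, all `c_n ∈ ℤ_p`. If
`‖c_{np-1} - c_{n-1}‖ ≤ ‖np‖` for every `n ≥ 1` (i.e. `c_{np-1} ≡ c_{n-1} (mod pn ℤ_p)`), then
`exp(g) ∈ ℤ_p⟦z⟧`. [Blakestad–Grant 2023, Cor. 6 (a),(b); Koblitz GTM 58, IV §2 (Dwork's lemma)]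
[cite: BlakestadGrant2023, Cor. 6] -/
theorem _root_.Literature.NumberTheory.EllipticCurves.isPadicInt_exp_subst_of_norm_sub_le
    {g : ℚ_[p]⟦X⟧} (hg0 : constantCoeff g = 0) {c : ℕ → ℚ_[p]} (hc : ∀ n, ‖c n‖ ≤ 1)
    (hgc : ∀ n, coeff (n + 1) (X * d⁄dX ℚ_[p] g) = c n)
    (hcong : ∀ n, ‖c ((n + 1) * p - 1) - c n‖ ≤ ‖(((n + 1) * p : ℕ) : ℚ_[p])‖) :
    IsPadicInt ((exp ℚ_[p]).subst g) := by
  have hp : p.Prime := Fact.out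
  set A := PadicInt.subring p with hA
  have hcA : ∀ n, c n ∈ A := fun n => (PadicInt.mem_subring_iff p).mpr (hc n)
  -- `[z^{n+1}] g = c_n/(n+1)`
  have hga : ∀ n, coeff (n + 1) g = algebraMap ℚ ℚ_[p] (1 / (n + 1 : ℕ)) * c n := by
    intro n
    have h := hgc n
    rw [coeff_succ_X_mul, coeff_derivative] at h
    have hn : ((n : ℚ_[p]) + 1) ≠ 0 := by exact_mod_cast Nat.succ_ne_zero n
    rw [map_div₀, map_one, map_natCast, Nat.cast_succ, ← h]
    field_simp
  -- the congruences give the functional equation `g - p⁻¹ g(zᵖ) ∈ ℤ_p⟦z⟧`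
  have hfe : ∀ m, coeff m (g - (p : ℚ)⁻¹ • expand p hp.ne_zero (g.map (RingHom.id ℚ_[p]))) ∈ A := by
    refine (coeff_sub_expand_mem_iff p A (RingHom.id ℚ_[p]) (padic_inv_natCast_mem_subring p) hcA hg0
      hga).mpr fun n => ?_
    have hN : ((((n + 1) * p : ℕ) : ℚ_[p])) ≠ 0 := by
      exact_mod_cast Nat.mul_ne_zero (Nat.succ_ne_zero n) hp.ne_zero
    refine ⟨(c ((n + 1) * p - 1) - c n) / (((n + 1) * p : ℕ) : ℚ_[p]), ?_, ?_⟩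
    · rw [hA, PadicInt.mem_subring_iff, norm_div, div_le_one (norm_pos_iff.mpr hN)]
      exact hcong n
    · rw [RingHom.id_apply, mul_div_cancel₀ _ hN]
  have hmem := coeff_exp_subst_mem_of_functionalEquation p A (RingHom.id ℚ_[p])
    (padic_inv_natCast_mem_subring p) (padic_exists_pow_mul_mem_subring p) (fun r hr => hr)
    (padicInt_exists_eq_pow_add p) hg0 hfe
  exact isPadicInt_iff_coeff.mpr fun n => (PadicInt.mem_subring_iff p).mp (hmem n)

end Dwork

/-! ### The named fact reduced to congruences for `ζ·ω` -/

/-- **`mazur_tate_sigma_existsUnique` follows from Atkin–Swinnerton-Dyer/Dwork congruences for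
the zeta differential.** Suppose that for every prime `p ≥ 5`, every short `p`-integral model
`V/ℚ_p` with `‖Δ‖ = 1` and unit Hasse coefficient `‖w_{p-1}‖ = 1`, and every `β ∈ ℤ_p` and even
`Λ ∈ 1 + zℤ_p⟦z⟧` with `η(zΛ' - Λ) = -(X - βz²)` (the integral odd solution `ζ = Λ/z` of
`Dζ = -x + β`, Blakestad–Grant Thm. 2), the coefficients `d_k = [z^k](Λ·ω/dz)` of the differential
`ζω = Σ d_k z^{k-1} dz` satisfy `‖d_{(n+1)p} - d_{n+1}‖ ≤ ‖(n+1)p‖` for all `n` — then the tree's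
named fact holds (Mazur–Stein–Tate 2006 Thm. 1.3). Indeed `zg' = Λω - 1` has coefficients
`c_{n} = d_{n+1}`, so `exp(g) ∈ ℤ_p⟦z⟧` by Dieudonné–Dwork, and
`mazur_tate_sigma_existsUnique_of_exp_integral` applies. [Blakestad–Grant 2023, Thm. 1 with
Cor. 6 and Prop. 13 (the congruences their proof establishes); Mazur–Stein–Tate 2006, Thm. 1.3]
[cite: BlakestadGrant2023, Thm. 1] -/
theorem mazur_tate_sigma_existsUnique_of_zeta_congruences
    (H : ∀ (p : ℕ) [Fact p.Prime] (V : WeierstrassCurve ℚ_[p]) [V.IsIntegral ℤ_[p]] [V.IsShortNF],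
      5 ≤ p → ‖V.Δ‖ = 1 → ‖coeff (p - 1) V.formalOmega‖ = 1 →
      ∀ (β : ℚ_[p]) (Λ : ℚ_[p]⟦X⟧), ‖β‖ ≤ 1 → IsPadicInt Λ → constantCoeff Λ = 1 →
        rescale (-1 : ℚ_[p]) Λ = Λ →
        V.formalEta * (X * d⁄dX ℚ_[p] Λ - Λ) = -(V.formalXMulSq - C β * X ^ 2) →
        ∀ n : ℕ, ‖coeff ((n + 1) * p) (Λ * V.formalOmega) - coeff (n + 1) (Λ * V.formalOmega)‖ ≤
          ‖(((n + 1) * p : ℕ) : ℚ_[p])‖) :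
    mazur_tate_sigma_existsUnique := by
  refine mazur_tate_sigma_existsUnique_of_exp_integral
    fun p _ V _ _ hp hΔ hA β Λ g hβ hΛint hΛ0 hΛe hΛ hg0 hg => ?_
  have hΛω : IsPadicInt (Λ * V.formalOmega) := hΛint.mul V.isPadicInt_formalOmega
  refine isPadicInt_exp_subst_of_norm_sub_le hg0 (c := fun n => coeff (n + 1) (Λ * V.formalOmega))
    (fun n => isPadicInt_iff_coeff.mp hΛω _) (fun n => ?_) fun n => ?_
  · rw [hg, map_sub, coeff_one, if_neg (Nat.succ_ne_zero n), sub_zero]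
  · have hidx : (n + 1) * p - 1 + 1 = (n + 1) * p :=
      Nat.sub_add_cancel (Nat.mul_pos (Nat.succ_pos n) (Fact.out : p.Prime).pos)
    simp only [hidx]
    exact H p V hp hΔ hA β Λ hβ hΛint hΛ0 hΛe hΛ n

end WeierstrassCurve
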